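import Mathlib
import HarnessLib
import Summits.HubbardSuperconductivity.HubbardSuperconductivity.Theorems.KLProgrammeKLRegimeSectorSliceDefectPairFatSectional
import Summits.HubbardSuperconductivity.HubbardSuperconductivity.Theorems.KLProgrammeKLRegimeSectorSliceDefectRowsFat

/-!
# K3 VL child `KLRegimeVolumeLimitV17F2` (stmt-HubbardSuperconductivity-20440), located item #23 «W2-HALF-VL», COV/SEC shallow half, sectional brick S2: the
# SECTIONAL per-pair bound of the sectorised slice DEFECT for EVERY pair — the integer frame vector built from the sector's Fermi point

Cell `gate-hubbard-kl`, seat p3 (g16), lead of #23.  The fixed-time twin of k3c4-p2's `sliceDefectPairWt_bgmFat_le_all` (`…SectorSliceDefectRowsFat`): p3 g13's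
sectional per-pair lemma `sliceDefectPairWt_bgmFat_sectional_le` (`…SectorSliceDefectPairFatSectional`, p605162) asks for an integer tangent vector `v` of the
sector `ω`; as there it is `v = round(N_r·t̂)` (`tangentStep_bounds`, `sub_one_le_sqrt_sum_sq_round`).  Same section binders as p605162.

* **`sliceDefectPairWt_bgmFat_sectional_le_all`** — the conclusion of `sliceDefectPairWt_bgmFat_sectional_le` for every pair `(ω, ω′)`, no frame-vector
  hypotheses left.

Everything is proved; no definitions, no sorry.  Nothing asserts any stub, K3, VL or superconductivity. [cite: BenfattoGiulianiMastropietro2006, §2.8 (2.81), §3 (3.2)–(3.8)]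
-/

noncomputable section

namespace Summit.HubbardSuperconductivity.HubbardSuperconductivity.Theorems.TorusFourierL2

set_option linter.dupNamespace false -- summit = problem name (single-conjunct summit), D-0017

open Set Finset Literature.MathematicalPhysics.QuantumLattice Literature.MathematicalPhysics.QuantumLattice.BandSectorCounting
open Literature.MathematicalPhysics.QuantumLattice.FermiRG Literature.Probability.LatticeModels Literature.Analysis.SpecialFunctions
open Summit.HubbardSuperconductivity.HubbardSuperconductivity.Theorems.DispersionFlow
open Summit.HubbardSuperconductivity.HubbardSuperconductivity.Theorems.KLRegimeSplit
open Summit.HubbardSuperconductivity.HubbardSuperconductivity.Theorems.KLProgrammeLegKernels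
open Summit.HubbardSuperconductivity.HubbardSuperconductivity.Theorems.PerturbedFermiCurve
open scoped Real Nat


/-! ## The uniform weighted per-pair bound of the slice DEFECT for the fat family, closed form, arbitrary positive rates -/

section PairBoundAll

open Classical

variable {L M : ℕ} [NeZero L] [NeZero M] {a b : ℝ} (B : BandBounds a b) {K K' : TrigPolyC4v} {A : ℝ}
  (hA : ∀ p : Momentum, ∀ j ≤ 2, ‖iteratedFDeriv ℝ j (frameShift K) p‖ ≤ A) (hADt : 2 * A < B.Dtmin)
  {μ e₀ z β : ℝ} (he : 0 < e₀) (hz : 0 < z) (hz1 : z ≤ 1) (hgap : e₀ + A + z ^ 2 < -μ) (h3 : e₀ + A - μ ≤ 3)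
  (hlo : a ≤ μ - A - e₀) (hhi : μ + A + e₀ ≤ b) (hβ : 0 < β) (hρA : 4 * A < 2 * B.rhomin)
  (m : ℕ) (hMm : klScale e₀ m * β < π * (2 * M - 5))
  {d : ℝ} (hd : 0 ≤ d) (hd1 : ∀ u, |deriv (bgmCutoffSq e₀) u| ≤ d) (hd2 : ∀ u, |iteratedDeriv 2 (bgmCutoffSq e₀) u| ≤ d)
  (hd3 : ∀ u, |iteratedDeriv 3 (bgmCutoffSq e₀) u| ≤ d)
  {A₃ a₃ : ℝ} (hA3 : ∀ p : Momentum, ‖iteratedFDeriv ℝ 3 (frameShift K) p‖ ≤ A₃) (ha3 : A₃ * klScale e₀ m ^ 2 ≤ a₃)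
  {Ba : ℝ} (hB0 : 0 ≤ Ba)
  (hB : ∀ (i : ℕ), i ≤ 2 → ∀ (n : ℕ) (ω : ℤ) (θ₀ : ℝ) (q w : Fin 2 → ℝ) (t : ℝ) {r₀ : ℝ}, 0 < r₀ →
    r₀ ≤ ‖momToComplex (q + t • w)‖ → |sectorRelAngle θ₀ (q + t • w)| < π →
    ‖iteratedDeriv i (fun t : ℝ => sectorWeightCirc n ω (polarAngle (q + t • w))) t‖ ≤
      (2 : ℕ)! * Ba * ((1 + (sectorWidth n)⁻¹ * (2 : ℕ)!) * ‖momToComplex w‖ / r₀) ^ i)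
  {Ba3 : ℝ} (hB30 : 0 ≤ Ba3)
  (hB3 : ∀ (i : ℕ), i ≤ 3 → ∀ (n : ℕ) (ω : ℤ) (θ₀ : ℝ) (q w : Fin 2 → ℝ) (t : ℝ) {r₀ : ℝ}, 0 < r₀ →
    r₀ ≤ ‖momToComplex (q + t • w)‖ → |sectorRelAngle θ₀ (q + t • w)| < π →
    ‖iteratedDeriv i (fun t : ℝ => sectorWeightCirc n ω (polarAngle (q + t • w))) t‖ ≤
      (3 : ℕ)! * Ba3 * ((1 + (sectorWidth n)⁻¹ * (3 : ℕ)!) * ‖momToComplex w‖ / r₀) ^ i)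
  -- the slice and the Euclidean frame data of the propagator side (frame `K`)
  {Λ Λ' : ℝ} (hΛ : 0 < Λ) (hΛΛ' : Λ ≤ Λ')
  {K₁ K₂ K₃ : ℝ} (hK₁ : ∀ p, ‖fderiv ℝ (frameLevel μ K) p‖ ≤ K₁) (hK₂ : ∀ p, ‖iteratedFDeriv ℝ 2 (frameLevel μ K) p‖ ≤ K₂)
  (hK₃ : ∀ p, ‖iteratedFDeriv ℝ 3 (frameLevel μ K) p‖ ≤ K₃)
  {B₁ B₂ B₃ B₄ : ℝ} (hB₁ : ∀ x, |deriv salmhoferCutoff x| ≤ B₁) (hB₂ : ∀ x, |deriv (deriv salmhoferCutoff) x| ≤ B₂)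
  (hB₃ : ∀ x, |deriv (deriv (deriv salmhoferCutoff)) x| ≤ B₃) (hB₄ : ∀ x, |deriv (deriv (deriv (deriv salmhoferCutoff))) x| ≤ B₄)
  -- the band increment `e_{K′} − e_K` of the second frame
  {P₀ P₁ P₂ P₃ : ℝ} (hv₀ : ∀ p, |frameLevel μ K' p - frameLevel μ K p| ≤ P₀)
  (hv₁ : ∀ p, ‖fderiv ℝ (fun p => frameLevel μ K' p - frameLevel μ K p) p‖ ≤ P₁)
  (hv₂ : ∀ p, ‖iteratedFDeriv ℝ 2 (fun p => frameLevel μ K' p - frameLevel μ K p) p‖ ≤ P₂)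
  (hv₃ : ∀ p, ‖iteratedFDeriv ℝ 3 (fun p => frameLevel μ K' p - frameLevel μ K p) p‖ ≤ P₃)
  -- tangent resolution, zone margin for the steps, far-region radius
  {Nr : ℝ} (hNr : 2 ≤ Nr) (hLz : 3 * |2 * π / L| * (Nr + 1 / 2) ≤ z) {R₀ : ℕ} (hR₀ : 2 * (2 * Nr + 1) * (R₀ : ℝ) < L)
  -- abbreviations (instantiate with `rfl`)
  {ℓ₁ ℓ ρf G₁ G₂ G₃ Kp wsi τt Ae1 Ae2 An1 An2 Av1 Av2 κ₃F : ℝ}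
  (hℓ₁ : ℓ₁ = 2 * π / L) (hℓ : ℓ = 2 * π / L * (Nr + 1 / 2))
  (hρf : ρf = (klScale e₀ m + B.smax * B.Dtmin * (3 * sectorWidth (m + 1) / 4)) / (B.Dtmin - 2 * A) +
    π * Real.sqrt 2 * (1 + (4 + 2 * A) / (B.Dtmin - 2 * A)) * sectorWidth (m + 1))
  (hG₁ : G₁ = d * e₀ ^ 2 * 1 + 1 * (d * e₀ ^ 2)) (hG₂ : G₂ = d * e₀ ^ 4 * 1 + 2 * (d * e₀ ^ 2) * (d * e₀ ^ 2) + 1 * (d * e₀ ^ 4))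
  (hG₃ : G₃ = d * e₀ ^ 6 * 1 + 3 * (d * e₀ ^ 4) * (d * e₀ ^ 2) + 3 * (d * e₀ ^ 2) * (d * e₀ ^ 4) + 1 * (d * e₀ ^ 6))
  (hκ₃F : κ₃F = (8 * G₃ + 12 * G₂) * (4 + 2 * A) ^ 3 + (12 * G₂ + 6 * G₁) * (4 + 2 * A) * (4 + 4 * A) * e₀ +
      2 * G₁ * (4 * e₀ ^ 2 + 8 * a₃) +
      216 * 9 * Ba3 * ((4 * G₂ + 2 * G₁) * (4 + 2 * A) ^ 2 * (2 * e₀) + 2 * G₁ * (4 + 4 * A) * e₀ * (2 * e₀)) +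
      216 * 9 * G₁ * (4 + 2 * A) * (12 * Ba3 + 72 * Ba3 ^ 2) * (2 * e₀) ^ 2 + 216 * 9 * (12 * Ba3 + 216 * Ba3 ^ 2) * (2 * e₀) ^ 3)
  (hKp : Kp = 4 + 4 * A) (hwsi : wsi = (sectorWidth (m + 1))⁻¹)
  (hτt : τt = |2 * π / L| * (4 + 2 * A) + K₂ * (Real.sqrt 2 * ρf) * (Real.sqrt 2 * ℓ))
  (hAe1 : Ae1 = 2 * G₁ * ((4 + 2 * A) * ℓ₁ + Kp * (ρf + 2 * ℓ₁) * ℓ₁) / klScale e₀ m * 1 + 1 * 1 * (9 * (4 * Ba * ((1 + 2 * wsi) * (2 * ℓ₁)))))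
  (hAe2 : Ae2 = ((4 * G₂ + 2 * G₁) * ((4 + 2 * A) * ℓ₁ + Kp * (ρf + 2 * ℓ₁) * ℓ₁) ^ 2 / klScale e₀ m ^ 2 + 2 * G₁ * (Kp * ℓ₁ ^ 2) / klScale e₀ m) * 1 +
    4 * G₁ * ((4 + 2 * A) * ℓ₁ + Kp * (ρf + 2 * ℓ₁) * ℓ₁) / klScale e₀ m * (9 * (4 * Ba * ((1 + 2 * wsi) * (2 * ℓ₁)))) +
    1 * 1 * (9 * (4 * Ba * ((1 + 2 * wsi) * (2 * ℓ₁)) ^ 2 + 8 * Ba ^ 2 * ((1 + 2 * wsi) * (2 * ℓ₁)) ^ 2)))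
  (hAn1 : An1 = 2 * G₁ * ((4 + 2 * A) * ℓ + Kp * (ρf + 2 * ℓ) * ℓ) / klScale e₀ m * 1 + 1 * 1 * (9 * (4 * Ba * ((1 + 2 * wsi) * (2 * ℓ)))))
  (hAn2 : An2 = ((4 * G₂ + 2 * G₁) * ((4 + 2 * A) * ℓ + Kp * (ρf + 2 * ℓ) * ℓ) ^ 2 / klScale e₀ m ^ 2 + 2 * G₁ * (Kp * ℓ ^ 2) / klScale e₀ m) * 1 +
    4 * G₁ * ((4 + 2 * A) * ℓ + Kp * (ρf + 2 * ℓ) * ℓ) / klScale e₀ m * (9 * (4 * Ba * ((1 + 2 * wsi) * (2 * ℓ)))) +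
    1 * 1 * (9 * (4 * Ba * ((1 + 2 * wsi) * (2 * ℓ)) ^ 2 + 8 * Ba ^ 2 * ((1 + 2 * wsi) * (2 * ℓ)) ^ 2)))
  (hAv1 : Av1 = 2 * G₁ * (|2 * π / L| * (4 + 2 * A) + Kp * (ρf + 2 * ℓ) * ℓ) / klScale e₀ m * 1 + 1 * 1 * (9 * (4 * Ba * ((1 + 2 * wsi) * (2 * ℓ)))))
  (hAv2 : Av2 = ((4 * G₂ + 2 * G₁) * (|2 * π / L| * (4 + 2 * A) + Kp * (ρf + 2 * ℓ) * ℓ) ^ 2 / klScale e₀ m ^ 2 + 2 * G₁ * (Kp * ℓ ^ 2) / klScale e₀ m) * 1 +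
    4 * G₁ * (|2 * π / L| * (4 + 2 * A) + Kp * (ρf + 2 * ℓ) * ℓ) / klScale e₀ m * (9 * (4 * Ba * ((1 + 2 * wsi) * (2 * ℓ)))) +
    1 * 1 * (9 * (4 * Ba * ((1 + 2 * wsi) * (2 * ℓ)) ^ 2 + 8 * Ba ^ 2 * ((1 + 2 * wsi) * (2 * ℓ)) ^ 2)))
  -- the increment polynomials and the closed amplitude (instantiate with `rfl`)
  {X₀ X₁ X₂ X₃ Tt : ℝ}
  (hX₀ : X₀ = (16 * B₁ + 16) * (β * (L : ℝ) ^ 2) / Λ ^ 2 * P₀)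
  (hX₁ : X₁ = (32 * B₂ + 144 * B₁ + 128) * (β * (L : ℝ) ^ 2) / Λ ^ 3 * P₀ * (K₁ + P₁) + (16 * B₁ + 16) * (β * (L : ℝ) ^ 2) / Λ ^ 2 * P₁)
  (hX₂ : X₂ = (64 * B₃ + 480 * B₂ + 1728 * B₁ + 1536) * (β * (L : ℝ) ^ 2) / Λ ^ 4 * P₀ * (K₁ + P₁) ^ 2 +
    (32 * B₂ + 144 * B₁ + 128) * (β * (L : ℝ) ^ 2) / Λ ^ 3 * (P₁ * (2 * K₁ + P₁)) +
    ((32 * B₂ + 144 * B₁ + 128) * (β * (L : ℝ) ^ 2) / Λ ^ 3 * P₀ * (K₂ + P₂) + (16 * B₁ + 16) * (β * (L : ℝ) ^ 2) / Λ ^ 2 * P₂))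
  (hX₃ : X₃ = (128 * B₄ + 1408 * B₃ + 7776 * B₂ + 27648 * B₁ + 24576) * (β * (L : ℝ) ^ 2) / Λ ^ 5 * P₀ * (K₁ + P₁) ^ 3 +
    (64 * B₃ + 480 * B₂ + 1728 * B₁ + 1536) * (β * (L : ℝ) ^ 2) / Λ ^ 4 * (P₁ * (3 * K₁ ^ 2 + 3 * K₁ * P₁ + P₁ ^ 2)) +
    3 * ((64 * B₃ + 480 * B₂ + 1728 * B₁ + 1536) * (β * (L : ℝ) ^ 2) / Λ ^ 4 * P₀ * ((K₁ + P₁) * (K₂ + P₂)) +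
      (32 * B₂ + 144 * B₁ + 128) * (β * (L : ℝ) ^ 2) / Λ ^ 3 * (K₁ * P₂ + P₁ * K₂ + P₁ * P₂)) +
    ((32 * B₂ + 144 * B₁ + 128) * (β * (L : ℝ) ^ 2) / Λ ^ 3 * P₀ * (K₃ + P₃) + (16 * B₁ + 16) * (β * (L : ℝ) ^ 2) / Λ ^ 2 * P₃))
  (hTt : Tt = (1 / (β * (L : ℝ) ^ 2)) ^ 2 *
    (1 * ((2 * π / β) ^ 3 * ((128 * B₄ + 1216 * B₃ + 6912 * B₂ + 26112 * B₁ + 24576) * (β * (L : ℝ) ^ 2) / Λ ^ 5 * P₀)) +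
      3 * ((2 * G₁ * |2 * π / β| * 1 / klScale e₀ m) * ((2 * π / β) ^ 2 * ((64 * B₃ + 416 * B₂ + 1600 * B₁ + 1536) * (β * (L : ℝ) ^ 2) / Λ ^ 4 * P₀))) +
      3 * (((4 * G₂ + 2 * G₁) * (2 * π / β) ^ 2 * 1 / klScale e₀ m ^ 2) * ((2 * π / β) * ((32 * B₂ + 128 * B₁ + 128) * (β * (L : ℝ) ^ 2) / Λ ^ 3 * P₀))) +
      ((8 * G₃ + 12 * G₂) * |2 * π / β| ^ 3 * 1 / klScale e₀ m ^ 3) * ((16 * B₁ + 16) * (β * (L : ℝ) ^ 2) / Λ ^ 2 * P₀)))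

include B hA hADt he hz hz1 hgap h3 hlo hhi hβ hρA hMm hd hd1 hd2 hd3 hA3 ha3 hB0 hB hB30 hB3 hΛ hΛΛ' hK₁ hK₂ hK₃ hB₁ hB₂ hB₃ hB₄
  hv₀ hv₁ hv₂ hv₃ hNr hLz hR₀ hℓ₁ hℓ hρf hG₁ hG₂ hG₃ hκ₃F hKp hwsi hτt hAe1 hAe2 hAn1 hAn2 hAv1 hAv2 hX₀ hX₁ hX₂ hX₃ in
set_option maxHeartbeats 4000000 in
/-- **The uniform SECTIONAL per-pair bound of the slice DEFECT for the fat family, every pair** (see the module docstring).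
[cite: BenfattoGiulianiMastropietro2006, §2.8 (2.81), §3 (3.2)–(3.8)] -/
theorem sliceDefectPairWt_bgmFat_sectional_le_all (ω ω' : Fin (sectorCount (m + 1)))
    {s₀ s₁ s₂ s₃ s₃' : ℝ} (hs₀ : 0 < s₀) (hs₁ : 0 < s₁) (hs₂ : 0 < s₂) (hs₃ : 0 < s₃) (hs₃' : 0 < s₃')
    {AΔ : ℝ} (hAΔ : AΔ = (1 / (β * (L : ℝ) ^ 2)) ^ 2 * X₀ +
      (1 / (β * (L : ℝ) ^ 2)) ^ 2 * ((Real.sqrt 2 * ℓ₁) ^ 3 * X₃ + 3 * (Ae1 * ((Real.sqrt 2 * ℓ₁) ^ 2 * X₂)) +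
        3 * (Ae2 * ((Real.sqrt 2 * ℓ₁) * X₁)) + κ₃F * ℓ₁ ^ 3 / klScale e₀ m ^ 3 * X₀) / (4 / (s₁ * L)) ^ 3 +
      (1 / (β * (L : ℝ) ^ 2)) ^ 2 * ((Real.sqrt 2 * ℓ) ^ 3 * X₃ + 3 * (An1 * ((Real.sqrt 2 * ℓ) ^ 2 * X₂)) +
        3 * (An2 * ((Real.sqrt 2 * ℓ) * X₁)) + κ₃F * ℓ ^ 3 / klScale e₀ m ^ 3 * X₀) / (4 / (s₂ * L)) ^ 3 +
      (1 / (β * (L : ℝ) ^ 2)) ^ 2 * ((Real.sqrt 2 * ℓ) ^ 2 * X₂ + 2 * (Av1 * ((Real.sqrt 2 * ℓ) * X₁)) + Av2 * X₀) / (4 / (s₃ * L)) ^ 2 +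
      (1 / (β * (L : ℝ) ^ 2)) ^ 2 * ((Real.sqrt 2 * ℓ) ^ 3 * X₃ + 3 * (Av1 * ((Real.sqrt 2 * ℓ) ^ 2 * X₂)) +
        3 * (Av2 * ((Real.sqrt 2 * ℓ) * X₁)) + κ₃F * ℓ ^ 3 / klScale e₀ m ^ 3 * X₀) / (4 / (s₃' * L)) ^ 3) :
    ∀ z₁ : TorusSite 1 (2 * M), ∑ z₂ : TorusSite 2 L,
        (1 + s₁ * |(((z₂ 0).valMinAbs : ℤ) : ℝ)| + s₁ * |(((z₂ 1).valMinAbs : ℤ) : ℝ)|) *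
        ‖∑ q : TorusSite 1 (2 * M) × TorusSite 2 L, (torusChar q.1 z₁ * torusChar q.2 z₂) •
          ((((1 / (β * (L : ℝ) ^ 2) : ℝ) : ℂ) ^ 2 *
            (bgmFatMultiplier L M e₀ β (nambuXiCT L μ K) (m + 1) ω (⟨(q.1 0).val, ZMod.val_lt (q.1 0)⟩, q.2) *
              bgmFatMultiplier L M e₀ β (nambuXiCT L μ K) (m + 1) ω' (⟨(q.1 0).val, ZMod.val_lt (q.1 0)⟩, q.2) *
              (sliceSymbolFnXi (β * (L : ℝ) ^ 2) 0 Λ Λ' (matsubaraFreq β M ⟨(q.1 0).val, ZMod.val_lt (q.1 0)⟩) (nambuXiCT L μ K' q.2) -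
                sliceSymbolFnXi (β * (L : ℝ) ^ 2) 0 Λ Λ' (matsubaraFreq β M ⟨(q.1 0).val, ZMod.val_lt (q.1 0)⟩) (nambuXiCT L μ K q.2)))))‖ ≤
      (klScale e₀ m * β / π + 3) * (Real.sqrt (524288 * (1 / s₀ + 1) *
          ((1 + 2 * Real.sqrt 2 * s₁ / (s₂ * (Nr - 1)) + 2 * Real.sqrt 2 * s₁ / (s₃' * (Nr - 1))) ^ 2 *
            ((2 * Real.sqrt 2 / (s₂ * (Nr - 1)) + 2) * (2 * Real.sqrt 2 / (s₃ * (Nr - 1)) + 2))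
            + (1 / s₁ + 1) ^ 2 / (1 + s₁ * R₀))) *
        Real.sqrt (24 * (L : ℝ) ^ 2 *
            ((Real.sqrt 2 * L * ((klScale e₀ m + (4 + 4 * A) * ρf ^ 2) / (2 * B.rhomin - 4 * A)) / π + 2) *
              (Real.sqrt 2 * L * (2 * ρf) / π + 2))) * AΔ) := by
  have hlo' : a ≤ μ - A := by linarith only [hlo, he]
  have hhi' : μ + A ≤ b := by linarith only [hhi, he]
  set pF : Fin 2 → ℝ := klFermiPoint μ K (sectorCenter (m + 1) (ω : ℕ)) with hpF
  set eK : (Fin 2 → ℝ) → ℝ := fun p => frameLevel μ K (WithLp.toLp 2 p) with heK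
  set g₀ : ℝ := fderiv ℝ eK pF (Pi.single 0 1) with hg₀
  set g₁ : ℝ := fderiv ℝ eK pF (Pi.single 1 1) with hg₁
  have hγ : 0 < 2 * B.rhomin - 4 * A := by linarith only [hρA]
  have hN0 : 0 < Real.sqrt (g₀ ^ 2 + g₁ ^ 2) := lt_of_lt_of_le hγ (gradient_floor_klFermiPoint B hA hlo' hhi' (sectorCenter (m + 1) (ω : ℕ)))
  -- the integer frame vector
  obtain ⟨v, hv⟩ : ∃ v : Fin 2 → ℤ, v = ![round (Nr * (-g₁ / Real.sqrt (g₀ ^ 2 + g₁ ^ 2))), round (Nr * (g₀ / Real.sqrt (g₀ ^ 2 + g₁ ^ 2)))] :=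
    ⟨_, rfl⟩
  have hv0 : v 0 = round (Nr * (-g₁ / Real.sqrt (g₀ ^ 2 + g₁ ^ 2))) := by rw [hv]; rfl
  have hv1 : v 1 = round (Nr * (g₀ / Real.sqrt (g₀ ^ 2 + g₁ ^ 2))) := by rw [hv]; rfl
  have hNr1 : 1 ≤ Nr := by linarith only [hNr]
  obtain ⟨htan, hvj, hvne⟩ := tangentStep_bounds eK pF (norm_fderiv_frameBand_le hA μ pF) hN0 hNr1 v hv0 hv1 (2 * π / L)
  -- its length
  have hunit : (-g₁ / Real.sqrt (g₀ ^ 2 + g₁ ^ 2)) ^ 2 + (g₀ / Real.sqrt (g₀ ^ 2 + g₁ ^ 2)) ^ 2 = 1 := by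
    have h := (frame_orthonormal hN0).2.1
    rw [neg_div]; exact h
  have hvlen : Nr - 1 ≤ Real.sqrt ((v 0 : ℝ) ^ 2 + (v 1 : ℝ) ^ 2) := by
    have h := sub_one_le_sqrt_sum_sq_round hNr (u := ![-g₁ / Real.sqrt (g₀ ^ 2 + g₁ ^ 2), g₀ / Real.sqrt (g₀ ^ 2 + g₁ ^ 2)]) hunit
    rw [hv0, hv1]
    exact h
  exact sliceDefectPairWt_bgmFat_sectional_le B hA hADt he hz hz1 hgap h3 hlo hhi hβ hρA m hMm hd hd1 hd2 hd3 hA3 ha3 hB0 hB hB30 hB3 hΛ hΛΛ' hK₁ hK₂ hK₃ hB₁ hB₂ hB₃ hB₄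
    hv₀ hv₁ hv₂ hv₃ hNr hLz hR₀ hℓ₁ hℓ hρf hG₁ hG₂ hG₃ hκ₃F hKp hwsi hτt hAe1 hAe2 hAn1 hAn2 hAv1 hAv2 hX₀ hX₁ hX₂ hX₃ ω ω' v hvne hvj hvlen htan
    hs₀ hs₁ hs₂ hs₃ hs₃' hAΔ

end PairBoundAll

end Summit.HubbardSuperconductivity.HubbardSuperconductivity.Theorems.TorusFourierL2

end
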